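import Mathlib.Analysis.Calculus.Deriv.Slope
import Mathlib.Topology.Order.IntermediateValue
import Literature.Analysis.FluidPDE.CompressibleEulerImplosionTrapping
import Literature.Analysis.FluidPDE.CompressibleEulerImplosionUniqueness
import Literature.Analysis.FluidPDE.CompressibleEulerImplosionNearPiece
import HarnessLib

/-!
# Graph barriers for the phase portrait of Buckmaster–Cao-Labora–Gómez-Serrano (γ = 5/3)

The barrier arguments of §§3–4 of the paper (Props. 3.1, 3.5, 4.1, 4.2) in the form used by the
`γ = 5/3` formalisation: a barrier is a continuous graph `Z = β(W)`, `C¹` away from finitely many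
kinks, and a solution `c = (W, Z)` of (1.8) with `W` decreasing cannot cross it as long as the
crossing quantity `G = N_Z D_W − β' N_W D_Z` (`Gfun`) has the right sign at every smooth point of
the graph (and, at a kink, for the piece to the left of the kink, the flow moving to the left
there: `N_W < 0`). The proof is a real induction in time (`forall_le_zero_of_local`), the local
step coming from the sign of the derivative of `Z − β(W)` along the solution,
`(d/dξ)(Z − β(W)) = G/(D_W D_Z)`.

[cite: BuckmasterCaolaboraGomezserrano2025, Prop. 3.1, Prop. 3.5, Prop. 4.1, Prop. 4.2]
-/

noncomputable section

open Set Filter Topology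

namespace Literature.Analysis.FluidPDE

namespace BuckmasterCaolaboraGomezserrano2025

namespace Monatomic

/-! ### Real induction with an abstract local step -/

/-- **Real induction.** A function continuous on `[a, b)`, nonpositive at `a`, which just after
every zero is again nonpositive, is nonpositive on `[a, b)`. [folklore] -/
theorem forall_le_zero_of_local {g : ℝ → ℝ} {a b : ℝ} (hcont : ∀ x ∈ Ico a b, ContinuousAt g x)
    (h0 : g a ≤ 0) (hstep : ∀ x ∈ Ico a b, g x = 0 → ∀ᶠ y in 𝓝[>] x, g y ≤ 0) :
    ∀ ξ ∈ Ico a b, g ξ ≤ 0 := by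
  intro ξ hξ
  set s : Set ℝ := {x | g x ≤ 0} with hs
  have hc : ContinuousOn g (Icc a ξ) := fun x hx =>
    (hcont x ⟨hx.1, lt_of_le_of_lt hx.2 hξ.2⟩).continuousWithinAt
  have hclosed : IsClosed (s ∩ Icc a ξ) := by
    have e : s ∩ Icc a ξ = Icc a ξ ∩ g ⁻¹' Iic 0 := by
      ext x; simp only [hs, mem_inter_iff, mem_setOf_eq, mem_preimage, mem_Iic]; tauto
    rw [e]
    exact hc.preimage_isClosed_of_isClosed isClosed_Icc isClosed_Iic
  have ha : a ∈ s := h0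
  have hgt : ∀ x ∈ s ∩ Ico a ξ, s ∈ 𝓝[>] x := by
    rintro x ⟨hx, hxI⟩
    have hxb : x ∈ Ico a b := ⟨hxI.1, hxI.2.trans hξ.2⟩
    have hx' : g x ≤ 0 := hx
    rcases lt_or_eq_of_le hx' with hlt | heq
    · have : ∀ᶠ y in 𝓝 x, g y < 0 := (hcont x hxb).eventually (gt_mem_nhds hlt)
      exact (this.filter_mono nhdsWithin_le_nhds).mono fun y hy => hy.le
    · exact hstep x hxb heq
  exact hclosed.Icc_subset_of_forall_mem_nhdsWithin ha hgt ⟨hξ.1, le_rfl⟩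

/-! ### The derivative of `Z − β(W)` along a solution -/

/-- [folklore] -/
theorem hasDerivAt_snd_sub_graph {r : ℝ} {c : ℝ → ℝ × ℝ} {ξ : ℝ} (hc : HasDerivAt c (field r (c ξ)) ξ)
    {βL : ℝ → ℝ} {m : ℝ} (hβ : HasDerivAt βL m (c ξ).1) :
    HasDerivAt (fun s => (c s).2 - βL (c s).1) ((field r (c ξ)).2 - m * (field r (c ξ)).1) ξ := by
  have h1 : HasDerivAt (fun s => (c s).1) (field r (c ξ)).1 ξ := hc.fst
  have h2 : HasDerivAt (fun s => (c s).2) (field r (c ξ)).2 ξ := hc.snd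
  have h3 : HasDerivAt (fun s => βL (c s).1) (m * (field r (c ξ)).1) ξ := hβ.comp ξ h1
  exact h2.sub h3

/-- The crossing quantity: `N_Z/D_Z − m N_W/D_W = G/(D_W D_Z)`. [cite: BuckmasterCaolaboraGomezserrano2025, eq. (3.3)] -/
theorem field_snd_sub_mul_fst {r W Z m : ℝ} (hW : DW W Z ≠ 0) (hZ : DZ W Z ≠ 0) :
    (field r (W, Z)).2 - m * (field r (W, Z)).1 = Gfun r W Z m / (DW W Z * DZ W Z) := by
  unfold field Gfun
  field_simp

/-! ### Graph barriers in `Ω = {D_W > 0 > D_Z}` (right of `P_s`), `W` decreasing in time -/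

/-- **Graph barrier, trajectory below.** Let `c` solve (1.8) on `[a, T)` inside
`Ω = {D_W > 0 > D_Z}` with `W > wlo` there, and let `β` be a continuous graph, differentiable off
a finite kink set `K`, such that at every smooth point `(w, β w)` of `Ω` with `w > wlo` the crossing
quantity is positive, and at every kink the flow moves left (`N_W < 0`) and the piece `βL` to the
left of the kink has positive crossing quantity at the kink. If `Z(a) ≤ β(W(a))` then
`Z ≤ β(W)` on `[a, T)`. [cite: BuckmasterCaolaboraGomezserrano2025, Prop. 4.1, Prop. 4.2] -/
theorem snd_le_graph_of_barrier {r : ℝ} {c : ℝ → ℝ × ℝ} {a T wlo : ℝ} {β : ℝ → ℝ} {K : Finset ℝ}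
    (hc : ∀ ξ ∈ Ico a T, HasDerivAt c (field r (c ξ)) ξ)
    (hΩ : ∀ ξ ∈ Ico a T, 0 < DW (c ξ).1 (c ξ).2 ∧ DZ (c ξ).1 (c ξ).2 < 0)
    (hrange : ∀ ξ ∈ Ico a T, wlo < (c ξ).1)
    (hβc : Continuous β)
    (hsmooth : ∀ w, w ∉ K → wlo < w → 0 < DW w (β w) → DZ w (β w) < 0 →
      ∃ m, HasDerivAt β m w ∧ 0 < Gfun r w (β w) m)
    (hkink : ∀ w ∈ K, wlo < w → 0 < DW w (β w) → DZ w (β w) < 0 →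
      NW r w (β w) < 0 ∧ ∃ (βL : ℝ → ℝ) (m : ℝ), HasDerivAt βL m w ∧ βL w = β w ∧
        (∀ᶠ v in 𝓝[<] w, βL v = β v) ∧ 0 < Gfun r w (β w) m)
    (h0 : (c a).2 ≤ β (c a).1) :
    ∀ ξ ∈ Ico a T, (c ξ).2 ≤ β (c ξ).1 := by
  set g : ℝ → ℝ := fun s => (c s).2 - β (c s).1 with hg
  have hcont : ∀ x ∈ Ico a T, ContinuousAt g x := fun x hx =>
    (hc x hx).continuousAt.snd.sub (hβc.continuousAt.comp (hc x hx).continuousAt.fst)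
  have hg0 : g a ≤ 0 := by simp only [hg]; linarith
  suffices h : ∀ ξ ∈ Ico a T, g ξ ≤ 0 by
    intro ξ hξ; have := h ξ hξ; simp only [hg] at this; linarith
  refine forall_le_zero_of_local hcont hg0 fun x hx hgx => ?_
  have hcx := hc x hx
  obtain ⟨hDW, hDZ⟩ := hΩ x hx
  have hZx : (c x).2 = β (c x).1 := by simp only [hg] at hgx; linarith
  have hDW' : 0 < DW (c x).1 (β (c x).1) := by rw [← hZx]; exact hDW
  have hDZ' : DZ (c x).1 (β (c x).1) < 0 := by rw [← hZx]; exact hDZ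
  have hneg : DW (c x).1 (c x).2 * DZ (c x).1 (c x).2 < 0 := mul_neg_of_pos_of_neg hDW hDZ
  have hcx' : HasDerivAt c (field r ((c x).1, (c x).2)) x := by simpa using hcx
  by_cases hK : (c x).1 ∈ K
  · -- kink
    obtain ⟨hNW, βL, m, hβL, hβLw, hloc, hG⟩ := hkink _ hK (hrange x hx) hDW' hDZ'
    -- `W` decreases through the kink
    have hW' : HasDerivAt (fun s => (c s).1) (field r (c x)).1 x := hcx.fst
    have hW'neg : (field r (c x)).1 < 0 := by
      show NW r (c x).1 (c x).2 / DW (c x).1 (c x).2 < 0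
      rw [hZx]; exact div_neg_of_neg_of_pos hNW hDW'
    have hWlt : ∀ᶠ y in 𝓝[>] x, (c y).1 < (c x).1 := ODE.eventually_lt_of_hasDerivAt_neg hW' hW'neg
    -- hence `β (W y) = βL (W y)` just after `x`
    have hWto : Tendsto (fun s => (c s).1) (𝓝[>] x) (𝓝[<] (c x).1) :=
      tendsto_nhdsWithin_of_tendsto_nhds_of_eventually_within _
        (tendsto_nhdsWithin_of_tendsto_nhds hW'.continuousAt.tendsto) hWlt
    have hβeq : ∀ᶠ y in 𝓝[>] x, βL (c y).1 = β (c y).1 := hWto.eventually hloc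
    -- the left piece is crossed downwards at `x`
    set gL : ℝ → ℝ := fun s => (c s).2 - βL (c s).1 with hgL
    have hgLd : HasDerivAt gL ((field r (c x)).2 - m * (field r (c x)).1) x :=
      hasDerivAt_snd_sub_graph hcx hβL
    have hval : (field r (c x)).2 - m * (field r (c x)).1 < 0 := by
      have e := field_snd_sub_mul_fst (r := r) (m := m) hDW.ne' hDZ.ne
      rw [show ((c x).1, (c x).2) = c x from rfl] at e
      rw [e, hZx]
      rw [hZx] at hneg
      exact div_neg_of_pos_of_neg hG hneg
    have hgLx : gL x = 0 := by simp only [hgL, hβLw]; linarith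
    have hlt := ODE.eventually_lt_of_hasDerivAt_neg hgLd hval
    filter_upwards [hlt, hβeq] with y hy hβy
    simp only [hgL, hg] at hy hgLx ⊢
    rw [hgLx] at hy
    rw [← hβy]; exact hy.le
  · -- smooth point
    obtain ⟨m, hβm, hG⟩ := hsmooth _ hK (hrange x hx) hDW' hDZ'
    have hgd : HasDerivAt g ((field r (c x)).2 - m * (field r (c x)).1) x :=
      hasDerivAt_snd_sub_graph hcx hβm
    have hval : (field r (c x)).2 - m * (field r (c x)).1 < 0 := by
      have e := field_snd_sub_mul_fst (r := r) (m := m) hDW.ne' hDZ.ne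
      rw [show ((c x).1, (c x).2) = c x from rfl] at e
      rw [e, hZx]
      rw [hZx] at hneg
      exact div_neg_of_pos_of_neg hG hneg
    have hlt := ODE.eventually_lt_of_hasDerivAt_neg hgd hval
    filter_upwards [hlt] with y hy
    rw [hgx] at hy; exact hy.le

/-- **Graph barrier, trajectory above.** Same as `snd_le_graph_of_barrier` with the opposite
orientation: negative crossing quantity, `Z(a) ≥ β(W(a))` gives `Z ≥ β(W)` on `[a, T)`.
[cite: BuckmasterCaolaboraGomezserrano2025, Prop. 4.1, Prop. 4.2] -/
theorem graph_le_snd_of_barrier {r : ℝ} {c : ℝ → ℝ × ℝ} {a T wlo : ℝ} {β : ℝ → ℝ} {K : Finset ℝ}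
    (hc : ∀ ξ ∈ Ico a T, HasDerivAt c (field r (c ξ)) ξ)
    (hΩ : ∀ ξ ∈ Ico a T, 0 < DW (c ξ).1 (c ξ).2 ∧ DZ (c ξ).1 (c ξ).2 < 0)
    (hrange : ∀ ξ ∈ Ico a T, wlo < (c ξ).1)
    (hβc : Continuous β)
    (hsmooth : ∀ w, w ∉ K → wlo < w → 0 < DW w (β w) → DZ w (β w) < 0 →
      ∃ m, HasDerivAt β m w ∧ Gfun r w (β w) m < 0)
    (hkink : ∀ w ∈ K, wlo < w → 0 < DW w (β w) → DZ w (β w) < 0 →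
      NW r w (β w) < 0 ∧ ∃ (βL : ℝ → ℝ) (m : ℝ), HasDerivAt βL m w ∧ βL w = β w ∧
        (∀ᶠ v in 𝓝[<] w, βL v = β v) ∧ Gfun r w (β w) m < 0)
    (h0 : β (c a).1 ≤ (c a).2) :
    ∀ ξ ∈ Ico a T, β (c ξ).1 ≤ (c ξ).2 := by
  set g : ℝ → ℝ := fun s => β (c s).1 - (c s).2 with hg
  have hcont : ∀ x ∈ Ico a T, ContinuousAt g x := fun x hx =>
    (hβc.continuousAt.comp (hc x hx).continuousAt.fst).sub (hc x hx).continuousAt.snd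
  have hg0 : g a ≤ 0 := by simp only [hg]; linarith
  suffices h : ∀ ξ ∈ Ico a T, g ξ ≤ 0 by
    intro ξ hξ; have := h ξ hξ; simp only [hg] at this; linarith
  refine forall_le_zero_of_local hcont hg0 fun x hx hgx => ?_
  have hcx := hc x hx
  obtain ⟨hDW, hDZ⟩ := hΩ x hx
  have hZx : (c x).2 = β (c x).1 := by simp only [hg] at hgx; linarith
  have hDW' : 0 < DW (c x).1 (β (c x).1) := by rw [← hZx]; exact hDW
  have hDZ' : DZ (c x).1 (β (c x).1) < 0 := by rw [← hZx]; exact hDZ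
  have hneg : DW (c x).1 (c x).2 * DZ (c x).1 (c x).2 < 0 := mul_neg_of_pos_of_neg hDW hDZ
  by_cases hK : (c x).1 ∈ K
  · obtain ⟨hNW, βL, m, hβL, hβLw, hloc, hG⟩ := hkink _ hK (hrange x hx) hDW' hDZ'
    have hW' : HasDerivAt (fun s => (c s).1) (field r (c x)).1 x := hcx.fst
    have hW'neg : (field r (c x)).1 < 0 := by
      show NW r (c x).1 (c x).2 / DW (c x).1 (c x).2 < 0
      rw [hZx]; exact div_neg_of_neg_of_pos hNW hDW'
    have hWlt : ∀ᶠ y in 𝓝[>] x, (c y).1 < (c x).1 := ODE.eventually_lt_of_hasDerivAt_neg hW' hW'neg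
    have hWto : Tendsto (fun s => (c s).1) (𝓝[>] x) (𝓝[<] (c x).1) :=
      tendsto_nhdsWithin_of_tendsto_nhds_of_eventually_within _
        (tendsto_nhdsWithin_of_tendsto_nhds hW'.continuousAt.tendsto) hWlt
    have hβeq : ∀ᶠ y in 𝓝[>] x, βL (c y).1 = β (c y).1 := hWto.eventually hloc
    set gL : ℝ → ℝ := fun s => βL (c s).1 - (c s).2 with hgL
    have hgLd : HasDerivAt gL (-((field r (c x)).2 - m * (field r (c x)).1)) x :=
      (hasDerivAt_snd_sub_graph hcx hβL).neg.congr_of_eventuallyEq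
        (Filter.Eventually.of_forall fun s => by
          show βL (c s).1 - (c s).2 = -((c s).2 - βL (c s).1); ring)
    have hval : -((field r (c x)).2 - m * (field r (c x)).1) < 0 := by
      have e := field_snd_sub_mul_fst (r := r) (m := m) hDW.ne' hDZ.ne
      rw [show ((c x).1, (c x).2) = c x from rfl] at e
      rw [e, hZx]
      rw [hZx] at hneg
      have : 0 < Gfun r (c x).1 (β (c x).1) m / (DW (c x).1 (β (c x).1) * DZ (c x).1 (β (c x).1)) :=
        div_pos_of_neg_of_neg hG hneg
      linarith
    have hgLx : gL x = 0 := by simp only [hgL, hβLw]; linarith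
    have hlt := ODE.eventually_lt_of_hasDerivAt_neg hgLd hval
    filter_upwards [hlt, hβeq] with y hy hβy
    simp only [hgL, hg] at hy hgLx ⊢
    rw [hgLx] at hy
    rw [← hβy]; exact hy.le
  · obtain ⟨m, hβm, hG⟩ := hsmooth _ hK (hrange x hx) hDW' hDZ'
    have hgd : HasDerivAt g (-((field r (c x)).2 - m * (field r (c x)).1)) x :=
      (hasDerivAt_snd_sub_graph hcx hβm).neg.congr_of_eventuallyEq
        (Filter.Eventually.of_forall fun s => by
          show β (c s).1 - (c s).2 = -((c s).2 - β (c s).1); ring)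
    have hval : -((field r (c x)).2 - m * (field r (c x)).1) < 0 := by
      have e := field_snd_sub_mul_fst (r := r) (m := m) hDW.ne' hDZ.ne
      rw [show ((c x).1, (c x).2) = c x from rfl] at e
      rw [e, hZx]
      rw [hZx] at hneg
      have : 0 < Gfun r (c x).1 (β (c x).1) m / (DW (c x).1 (β (c x).1) * DZ (c x).1 (β (c x).1)) :=
        div_pos_of_neg_of_neg hG hneg
      linarith
    have hlt := ODE.eventually_lt_of_hasDerivAt_neg hgd hval
    filter_upwards [hlt] with y hy
    rw [hgx] at hy; exact hy.le

/-! ### Graph barriers left of `P_s` (`D_W > 0`, `D_Z > 0`), `W` decreasing in time -/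

/-- **Lower graph barrier to the left of `P_s`** (Prop. 3.1/3.5 mechanism): in the region
`{D_W > 0, D_Z > 0}` a continuous, piecewise-`C¹` graph with positive crossing quantity at its
smooth points (and, at kinks, for the left piece, with `N_W < 0` there) cannot be crossed downwards:
`Z(a) ≥ β(W(a))` gives `Z ≥ β(W)` on `[a, T)`. [cite: BuckmasterCaolaboraGomezserrano2025, Prop. 3.1, Prop. 3.5] -/
theorem graph_le_snd_of_barrier_left {r : ℝ} {c : ℝ → ℝ × ℝ} {a T wlo whi : ℝ} {β : ℝ → ℝ}
    {K : Finset ℝ}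
    (hc : ∀ ξ ∈ Ico a T, HasDerivAt c (field r (c ξ)) ξ)
    (hD : ∀ ξ ∈ Ico a T, 0 < DW (c ξ).1 (c ξ).2 ∧ 0 < DZ (c ξ).1 (c ξ).2)
    (hrange : ∀ ξ ∈ Ico a T, wlo < (c ξ).1 ∧ (c ξ).1 < whi)
    (hβc : Continuous β)
    (hsmooth : ∀ w, w ∉ K → wlo < w → w < whi → 0 < DW w (β w) → 0 < DZ w (β w) →
      ∃ m, HasDerivAt β m w ∧ 0 < Gfun r w (β w) m)
    (hkink : ∀ w ∈ K, wlo < w → w < whi → 0 < DW w (β w) → 0 < DZ w (β w) →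
      NW r w (β w) < 0 ∧ ∃ (βL : ℝ → ℝ) (m : ℝ), HasDerivAt βL m w ∧ βL w = β w ∧
        (∀ᶠ v in 𝓝[<] w, βL v = β v) ∧ 0 < Gfun r w (β w) m)
    (h0 : β (c a).1 ≤ (c a).2) :
    ∀ ξ ∈ Ico a T, β (c ξ).1 ≤ (c ξ).2 := by
  set g : ℝ → ℝ := fun s => β (c s).1 - (c s).2 with hg
  have hcont : ∀ x ∈ Ico a T, ContinuousAt g x := fun x hx =>
    (hβc.continuousAt.comp (hc x hx).continuousAt.fst).sub (hc x hx).continuousAt.snd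
  have hg0 : g a ≤ 0 := by simp only [hg]; linarith
  suffices h : ∀ ξ ∈ Ico a T, g ξ ≤ 0 by
    intro ξ hξ; have := h ξ hξ; simp only [hg] at this; linarith
  refine forall_le_zero_of_local hcont hg0 fun x hx hgx => ?_
  have hcx := hc x hx
  obtain ⟨hDW, hDZ⟩ := hD x hx
  have hZx : (c x).2 = β (c x).1 := by simp only [hg] at hgx; linarith
  have hDW' : 0 < DW (c x).1 (β (c x).1) := by rw [← hZx]; exact hDW
  have hDZ' : 0 < DZ (c x).1 (β (c x).1) := by rw [← hZx]; exact hDZ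
  have hpos : 0 < DW (c x).1 (c x).2 * DZ (c x).1 (c x).2 := mul_pos hDW hDZ
  by_cases hK : (c x).1 ∈ K
  · obtain ⟨hNW, βL, m, hβL, hβLw, hloc, hG⟩ :=
      hkink _ hK (hrange x hx).1 (hrange x hx).2 hDW' hDZ'
    have hW' : HasDerivAt (fun s => (c s).1) (field r (c x)).1 x := hcx.fst
    have hW'neg : (field r (c x)).1 < 0 := by
      show NW r (c x).1 (c x).2 / DW (c x).1 (c x).2 < 0
      rw [hZx]; exact div_neg_of_neg_of_pos hNW hDW'
    have hWlt : ∀ᶠ y in 𝓝[>] x, (c y).1 < (c x).1 := ODE.eventually_lt_of_hasDerivAt_neg hW' hW'neg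
    have hWto : Tendsto (fun s => (c s).1) (𝓝[>] x) (𝓝[<] (c x).1) :=
      tendsto_nhdsWithin_of_tendsto_nhds_of_eventually_within _
        (tendsto_nhdsWithin_of_tendsto_nhds hW'.continuousAt.tendsto) hWlt
    have hβeq : ∀ᶠ y in 𝓝[>] x, βL (c y).1 = β (c y).1 := hWto.eventually hloc
    set gL : ℝ → ℝ := fun s => βL (c s).1 - (c s).2 with hgL
    have hgLd : HasDerivAt gL (-((field r (c x)).2 - m * (field r (c x)).1)) x :=
      (hasDerivAt_snd_sub_graph hcx hβL).neg.congr_of_eventuallyEq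
        (Filter.Eventually.of_forall fun s => by
          show βL (c s).1 - (c s).2 = -((c s).2 - βL (c s).1); ring)
    have hval : -((field r (c x)).2 - m * (field r (c x)).1) < 0 := by
      have e := field_snd_sub_mul_fst (r := r) (m := m) hDW.ne' hDZ.ne'
      rw [show ((c x).1, (c x).2) = c x from rfl] at e
      rw [e, hZx]
      rw [hZx] at hpos
      have : 0 < Gfun r (c x).1 (β (c x).1) m / (DW (c x).1 (β (c x).1) * DZ (c x).1 (β (c x).1)) :=
        div_pos hG hpos
      linarith
    have hgLx : gL x = 0 := by simp only [hgL, hβLw]; linarith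
    have hlt := ODE.eventually_lt_of_hasDerivAt_neg hgLd hval
    filter_upwards [hlt, hβeq] with y hy hβy
    simp only [hgL, hg] at hy hgLx ⊢
    rw [hgLx] at hy
    rw [← hβy]; exact hy.le
  · obtain ⟨m, hβm, hG⟩ := hsmooth _ hK (hrange x hx).1 (hrange x hx).2 hDW' hDZ'
    have hgd : HasDerivAt g (-((field r (c x)).2 - m * (field r (c x)).1)) x :=
      (hasDerivAt_snd_sub_graph hcx hβm).neg.congr_of_eventuallyEq
        (Filter.Eventually.of_forall fun s => by
          show β (c s).1 - (c s).2 = -((c s).2 - β (c s).1); ring)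
    have hval : -((field r (c x)).2 - m * (field r (c x)).1) < 0 := by
      have e := field_snd_sub_mul_fst (r := r) (m := m) hDW.ne' hDZ.ne'
      rw [show ((c x).1, (c x).2) = c x from rfl] at e
      rw [e, hZx]
      rw [hZx] at hpos
      have : 0 < Gfun r (c x).1 (β (c x).1) m / (DW (c x).1 (β (c x).1) * DZ (c x).1 (β (c x).1)) :=
        div_pos hG hpos
      linarith
    have hlt := ODE.eventually_lt_of_hasDerivAt_neg hgd hval
    filter_upwards [hlt] with y hy
    rw [hgx] at hy; exact hy.le

/-! ### Pieces of a piecewise-polynomial graph in a local coordinate -/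

/-- Derivative of a graph piece written in the local coordinate `u = (w − a)/ℓ`:
`(d/dw)(c₀ + P((w − a)/ℓ)) = P′/ℓ`. [folklore] -/
theorem hasDerivAt_const_add_comp_affine {P : ℝ → ℝ} {P' a ℓ c₀ w : ℝ}
    (hP : HasDerivAt P P' ((w - a) / ℓ)) :
    HasDerivAt (fun v => c₀ + P ((v - a) / ℓ)) (P' / ℓ) w := by
  have h1 : HasDerivAt (fun v : ℝ => (v - a) / ℓ) (1 / ℓ) w := by
    simpa using ((hasDerivAt_id w).sub_const a).div_const ℓ
  have h2 := hP.comp w h1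
  have h3 : HasDerivAt (fun v => c₀ + P ((v - a) / ℓ)) (0 + P' * (1 / ℓ)) w :=
    (hasDerivAt_const w c₀).add h2
  convert h3 using 1
  ring

/-- A function that agrees with a differentiable one near `w` has the same derivative there
(the form used for the pieces of a piecewise-defined barrier). [folklore] -/
theorem hasDerivAt_of_eqOn_Ioo {f g : ℝ → ℝ} {f' lo hi w : ℝ} (hlo : lo < w) (hhi : w < hi)
    (hg : HasDerivAt g f' w) (hfg : ∀ v, lo < v → v < hi → f v = g v) : HasDerivAt f f' w := by
  refine hg.congr_of_eventuallyEq ?_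
  have hmem : Ioo lo hi ∈ 𝓝 w := Ioo_mem_nhds hlo hhi
  filter_upwards [hmem] with v hv
  exact hfg v hv.1 hv.2

/-- Left-germ agreement from agreement on an interval `(lo, w]`. [folklore] -/
theorem eventuallyEq_nhdsLT_of_eqOn {f g : ℝ → ℝ} {lo w : ℝ} (hlo : lo < w)
    (hfg : ∀ v, lo < v → v ≤ w → f v = g v) : ∀ᶠ v in 𝓝[<] w, f v = g v := by
  have hmem : Ioo lo w ∈ 𝓝[<] w := Ioo_mem_nhdsLT hlo
  filter_upwards [hmem] with v hv
  exact hfg v hv.1 hv.2.le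

end Monatomic

end BuckmasterCaolaboraGomezserrano2025

end Literature.Analysis.FluidPDE
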